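/-
Copyright (c) 2026. All rights reserved.
Released under Apache 2.0 license as described in the file LICENSE.
Authors: HodgeCM publication cell (pub-hodgecm), GR lane, seat GR-1 (`pub-hodgecm-own-real34`).
-/
import Literature.NumberTheory.GelbartRogawski1991.Prop311PrintedL2OfRecord
import Literature.NumberTheory.GelbartRogawski1991.Prop311PrintedFormRescalingMp
import Literature.NumberTheory.GelbartRogawski1991.Prop311PrintedTrivialModel
import Literature.NumberTheory.GelbartRogawski1991.Prop311SkewHermitianOrthogonalBasis
import Literature.NumberTheory.GelbartRogawski1991.Prop311AsPrinted
import Literature.NumberTheory.Automorphic.AdeleAddCharClassification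
import Literature.NumberTheory.QuadraticForms.QuadraticExtensionPlaces
import HarnessLib

/-!
# [GelbartRogawski1991, Proposition 3.1.1] AS PRINTED (`Prop311AsPrinted`, every quadratic extension `E/F`) FROM THE RECORD
# for the dual-pair line data

Topic `NumberTheory/GelbartRogawski1991`; namespace `Literature.NumberTheory.GelbartRogawski1991.Prop311`.  Three definitions
(`Prop`s: the shapes of the input — line data ⊂ diagonal data ⊂ symmetric data) and theorems; no named fact is asserted, no
`sorry`, no instance attribute.

S. Gelbart, J. Rogawski, *L-functions and Fourier–Jacobi coefficients for the unitary group U(3)*, Invent. Math. 105 (1991),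
§3.1 Proposition 3.1.1, p. 455 L1–2, rendered statement-exact as `Prop311AsPrinted` (`Prop311AsPrinted.lean`): "for EVERY
quadratic extension of number fields `E/F` (conjugation `σ`), every non-trivial `ψ`, every skew-Hermitian `(V, Φ)`, every
irreducible unitary model `ρ` of `ρ_ψ` and THE rational splitting `i`: (1) the covering `π` splits over `G(𝐀)`; (2) there is a
continuous section `s : G(𝐀) → Mp_𝐀(W)` with `s(G(F)) ⊆ i(Sp_F(W))`."  The tree proves its body AT CM DATA
(`prop311AsPrinted_CM`, `prop311AsPrinted_specialization_CM`: `(F, E) = (L⁺, L)`), the one CM-bound input being the stage-1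
record `GRConstruction.gru_shape` (the doubling construction of the compatible splitting, typed for CM data).

THIS FILE reduces the WHOLE of `Prop311AsPrinted` to that input AT GENERAL `(F, E, σ)`:

* `PairLineCompatibleSplitting : Prop` — the statement the general-`(F, E, σ)` doubling construction is to deliver: for every
  quadratic extension `E/F` of number fields, every `F`-automorphism `σ` of `E` with `δ ∈ E`, `σ δ = -δ ≠ 0`, `δ² = d ∈ F`,
  every `f : Fin n → F` and line enumeration `e` with `T = diag(-2 d fᵢ)` invertible, the tree's dual-pair splitting datum with
  line second factor `pairLineDatum F E σ hσδ hδ hd f e hT` (`Prop311PrintedDualPairLine`: the unitary group `U(T ⊗ 1 ⊗ₖ 1)(𝐀_F)`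
  in `Sp(W_𝐀)`, Weil's metaplectic group `Mp_ψ(W_𝐀)ᶜᵒⁿᵗ`, Weil's rational section `r_F`) has a COMPATIBLE SPLITTING in the sense
  of the record `SplittingDatum.CompatibleSplitting` (a continuous `s : U(𝐀) →* Mp` over the inclusion with `s(U(F)) ⊆ r_F(Sp(F))`) —
  i.e. [GR91 Prop. 3.1.1] for these groups, in the tree's record form; at CM data it is the tree theorem
  `compatibleSplitting_pairLineDatum_CM` (`Prop311PrintedCM`, from `gru_shape`);
* **`prop311AsPrinted_of_pairLineCompatibleSplitting : PairLineCompatibleSplitting → Prop311AsPrinted`** — PROVED: for the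
  printed data, `E` is a number field (`NumberField.of_module_finite`), `σ ≠ 1` moves some `x`, and `δ := x - σ x` has
  `σ δ = -δ ≠ 0`, `δ² ∈ F` (`QuadraticExtension.exists_algebraMap_eq_of_fixed`); then the END assembly of `prop311AsPrinted_CM`
  runs at general `(F, E, σ, δ)`: the degenerate model (`conclusion_of_subsingleton`) ∨ [Tate's `ψ = ψ_F(ξ ·)`
  (`IsGlobalAddChar.exists_eq_mulShift_adeleAddChar`) → the rescaled space `(V, ξΦ)` (`Prop311PrintedFormRescaling`) → a
  `ξΦ`-orthogonal basis with `δ`-imaginary diagonal (`exists_orthogonal_basis_imaginary`) → the `L²(𝐀_Fⁿ)` model and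
  **`prop311_L2_of_record`** (`Prop311PrintedL2OfRecord`: the record → Steinhaus–Weil continuity → `legOfFrame` → the
  along-the-section socket; irreducibility from `Prop311RhoPsiL2Frame`) → uniqueness of `ρ_ψ` (`conclusion_of_conclusion`,
  `Prop311ModelIndependence`) → undo the rescaling (`conclusion_of_conclusion_smul`, `Prop311PrintedFormRescalingMp`)].

* `DiagonalCompatibleSplitting : Prop` — the same record for the general DUAL-PAIR datum with DIAGONAL hermitian data
  `dV : Fin N → F`, `dW : Fin M → F` (`UnitaryDualPair.splittingDatum F E c N M e (diag dV) (diag dW) …`): [GR91 Prop. 3.1.1]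
  for `G₁ = U(diag dV ⊗ diag dW)(𝐀_F)` — the exact shape of the stage-1 record `GRConstruction.gru_shape`
  (`cmSplittingDatum L e dV … dW …`) at general `(F, E, c)`, i.e. the END statement of the general doubling construction;
  **`pairLineCompatibleSplitting_of_diagonalCompatibleSplitting`** (J9 at general `(F, E, σ)`: `N = n`, `M = 1`,
  `dV = (-2 d fᵢ)`, `dW = 1`, `compatibleSplitting_splittingDatum_congr`) and
  **`prop311AsPrinted_of_diagonalCompatibleSplitting : DiagonalCompatibleSplitting → Prop311AsPrinted`**.

* `SymmetricCompatibleSplitting : Prop` — the same record for ALL symmetric invertible hermitian data `T_V ∈ GL_N(F)`, `T_W ∈ GL_M(F)`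
  (`J_V = T_V ⊗_F E`, `J_W = T_W ⊗_F E`), the telescope `(F E c hcδ hδ hd e TV hV hVd TW hW hWd)` of GR-2's general doubling files
  (`GRConstructionGen`); `diagonalCompatibleSplitting_of_symmetricCompatibleSplitting`,
  **`prop311AsPrinted_of_symmetricCompatibleSplitting : SymmetricCompatibleSplitting → Prop311AsPrinted`**.

So `theorem prop311AsPrinted_holds : Prop311AsPrinted` is ONE line away from a proof of `SymmetricCompatibleSplitting` or
`DiagonalCompatibleSplitting` (the general-`(F, E, σ)` doubling construction, programme parts A–C) or of
`PairLineCompatibleSplitting`.  Nothing in this file is a claim of the manuscripts adjudicated by the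
Hodge-CM cell; HC_CM is not touched.

## References
* [GelbartRogawski1991] S. Gelbart, J. Rogawski, Invent. Math. 105 (1991) 445–472, §1.1 p. 449 L26–32, §3.1 p. 454 L17–42,
  Proposition 3.1.1 p. 455 L1–2.
* [CasselsFrohlichANT1967] J. W. S. Cassels, A. Fröhlich (eds.), *Algebraic Number Theory* (1967), Ch. XV (Tate's thesis)
  Thm. 4.1.4 (characters of `𝐀/F`).
* [Weil1964] A. Weil, Acta Math. 111 (1964) 143–211, Chap. I n° 11–13, Chap. III n° 37–39.
-/

set_option autoImplicit false

noncomputable section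

open NumberField MeasureTheory Module
open scoped TensorProduct Matrix
open Literature.NumberTheory.Automorphic
open Literature.RepresentationTheory.HeisenbergGroup
open Literature.NumberTheory.Weil1964

namespace Literature.NumberTheory.GelbartRogawski1991

namespace Prop311

open UnitaryDualPair

/-- **The input of the general-`(F, E, σ)` programme: a compatible splitting of the dual-pair line datum for EVERY quadratic
extension** — [GelbartRogawski1991, Prop. 3.1.1] for the unitary groups `U(T ⊗ 1 ⊗ₖ 1)(𝐀_F)`, `T = diag(-2 d fᵢ)`, in the
tree's record form `SplittingDatum.CompatibleSplitting` (a continuous homomorphic section over the inclusion into `Sp(W_𝐀)`,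
mapping rational points into Weil's `r_F(Sp_F)`).  At CM data `(L⁺, L, conj, imagUnit L)` this is the tree theorem
`compatibleSplitting_pairLineDatum_CM` (from the stage-1 record `GRConstruction.gru_shape`).
[cite: GelbartRogawski1991, §3.1 Proposition 3.1.1, p. 455 L1–2; §3.2 p. 457] -/
def PairLineCompatibleSplitting : Prop :=
  ∀ (F : Type) [Field F] [NumberField F] (E : Type) [Field E] [NumberField E] [Algebra F E]
    [Algebra.IsQuadraticExtension F E] (σ : E ≃ₐ[F] E) (δ : E) (hσδ : σ δ = -δ) (hδ : δ ≠ 0) (d : F)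
    (hd : δ * δ = algebraMap F E d) (n : ℕ) (f : Fin n → F) (e : Fin n × Fin 1 ≃ Fin n)
    (_he : ∀ k : Fin n, (e.symm k).1 = k) (hT : IsUnit (symplecticGram F d f).det),
    (pairLineDatum F E σ hσδ hδ hd f e hT).CompatibleSplitting

/-- an `F`-automorphism `σ ≠ 1` of the quadratic extension `E/F` moves some `x`, and `δ := x - σ x` is a non-zero element with
`σ δ = -δ` and `δ² ∈ F` ("conjugation denoted by a bar", `E = F(δ)`). [cite: GelbartRogawski1991, §1.1 p. 449 L26] -/
theorem exists_delta_of_algEquiv_ne_one (F : Type) [Field F] [NumberField F] (E : Type) [Field E] [Algebra F E]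
    [Algebra.IsQuadraticExtension F E] (σ : E ≃ₐ[F] E) (hσ : σ ≠ 1) :
    ∃ (δ : E) (d : F), σ δ = -δ ∧ δ ≠ 0 ∧ δ * δ = algebraMap F E d := by
  haveI : CharZero F := inferInstance
  obtain ⟨x, hx⟩ : ∃ x : E, σ x ≠ x := by
    by_contra! h
    exact hσ (AlgEquiv.ext h)
  have hσδ : σ (x - σ x) = -(x - σ x) := by
    rw [map_sub, Literature.NumberTheory.QuadraticForms.QuadraticExtension.algEquiv_algEquiv_apply hσ x]; ring
  have hδ : x - σ x ≠ 0 := fun h => hx (sub_eq_zero.1 h).symm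
  have hfix : σ ((x - σ x) * (x - σ x)) = (x - σ x) * (x - σ x) := by rw [map_mul, hσδ, neg_mul_neg]
  obtain ⟨d, hd⟩ := Literature.NumberTheory.QuadraticForms.QuadraticExtension.exists_algebraMap_eq_of_fixed hσ hfix
  exact ⟨x - σ x, d, hσδ, hδ, hd.symm⟩

/-- **[GelbartRogawski1991, Proposition 3.1.1] AS PRINTED, for EVERY quadratic extension of number fields, FROM THE RECORD
for the dual-pair line data.**  Given `PairLineCompatibleSplitting` (a compatible splitting over `U(T ⊗ 1)(𝐀_F)` for every
quadratic `E/F` and every invertible diagonal `T = diag(-2 d fᵢ)`), the statement-exact typing `Prop311AsPrinted` holds: for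
every `E/F`, `σ ≠ 1`, non-trivial `ψ` of `F\𝐀`, skew-Hermitian `(V, Φ)` with `Tr Φ` non-degenerate, irreducible unitary model
`ρ` of `ρ_ψ` on a Hilbert space and THE rational splitting `i` — "(1) the covering `π` splits over `G(𝐀)`; (2) there exists a
continuous section `s : G(𝐀) → Mp_𝐀(W)` such that `s(G(F))` is contained in `i(Sp_F(W))`".
[cite: GelbartRogawski1991, §3.1 Proposition 3.1.1, p. 455 L1–2; §1.1 p. 449 L26–32; §3.1 p. 454 L17–42]
[cite: CasselsFrohlichANT1967, Ch. XV Thm 4.1.4] -/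
theorem prop311AsPrinted_of_pairLineCompatibleSplitting (hrec : PairLineCompatibleSplitting) : Prop311AsPrinted := by
  intro F _ _ E _ _ _ σ hσ ψ hψc hψF hψ1 n V _ _ _ _ _ hn Φ hΦ₁ hΦ₂ hΦ₃ hφ S _ _ _ ρ hρu hρc hρi hρz i hi _
  -- `E` is a number field; `δ` with `σ δ = -δ ≠ 0`, `δ² = d ∈ F`
  haveI : Module.Finite F E := Module.finite_of_finrank_eq_succ (Algebra.IsQuadraticExtension.finrank_eq_two F E)
  haveI : NumberField E := NumberField.of_module_finite F E
  have hdelta := exists_delta_of_algEquiv_ne_one F E σ hσ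
  obtain ⟨δ, d, hσδ, hδ, hd⟩ := hdelta
  -- (0) the degenerate model `S = 0`
  by_cases hS : Nontrivial S
  swap
  · haveI : Subsingleton S := not_nontrivial_iff_subsingleton.1 hS
    exact conclusion_of_subsingleton F E V Φ ρ i hi
  haveI : Nontrivial S := hS
  -- (1) Tate: `ψ = ψ_F(ξ ·)`
  -- (`have` before every `obtain`: `rcases` on a non-variable term generalizes it over this very large goal)
  have hψg : IsGlobalAddChar F ψ := ⟨hψc, hψF, hψ1⟩
  have hTate := hψg.exists_eq_mulShift_adeleAddChar
  obtain ⟨ξ, hξ, hψ⟩ := hTate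
  have hψ₀ := isGlobalAddChar_adeleAddChar F
  -- (2) the rescaled skew-Hermitian space `(V, ξΦ)`
  have hΦ₁' := smul_form_linear_left F E V Φ (ξ := ξ) hΦ₁
  have hΦ₂' := smul_form_semilinear_right F E V Φ (ξ := ξ) σ hΦ₂
  have hΦ₃' := smul_form_skew F E V Φ (ξ := ξ) σ hΦ₃
  have hφ' := nondegenerate_traceForm_smul F E V Φ hξ hφ
  -- (3) a `ξΦ`-orthogonal basis with `δ`-imaginary diagonal, and the line enumeration
  have hbasis := exists_orthogonal_basis_imaginary F E σ hσδ hδ hd (ξ • Φ) hΦ₁' hΦ₃'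
  obtain ⟨b, f, hb, hf⟩ := hbasis
  let e : Fin (finrank E V) × Fin 1 ≃ Fin (finrank E V) := Equiv.prodUnique (Fin (finrank E V)) (Fin 1)
  have he : ∀ k : Fin (finrank E V), (e.symm k).1 = k := fun k => rfl
  -- (4) a Haar measure on `𝐀_Fⁿ` and the `L²` model of `(V, ξΦ)` in the Darboux frame of `b`
  letI : MeasurableSpace (AdeleRing (𝓞 F) F) := borel _
  haveI : BorelSpace (AdeleRing (𝓞 F) F) := ⟨rfl⟩
  haveI : SecondCountableTopology (AdeleRing (𝓞 F) F) := secondCountableTopology_adeleRing _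
  haveI : LocallyCompactSpace (AdeleRing (𝓞 F) F) := locallyCompactSpace_adeleRing' _
  haveI : BorelSpace (Fin (finrank E V) → AdeleRing (𝓞 F) F) := Pi.borelSpace
  let ν : Measure (Fin (finrank E V) → AdeleRing (𝓞 F) F) := Measure.addHaarMeasure (Classical.arbitrary _)
  have hψc₀ : Continuous (adeleAddChar F : AdeleRing (𝓞 F) F → Circle) := hψ₀.continuous
  have hβc := continuous_adelicForm_left F (Fin (finrank E V))
    (1 : Matrix (Fin (finrank E V)) (Fin (finrank E V)) (AdeleRing (𝓞 F) F))
  -- (5) the body of Prop. 3.1.1 for the `L²` model of `(V, ξΦ)`, FROM THE RECORD at `(F, E, σ, δ; f, e)`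
  have hT := isUnit_det_lineGram_of_nondegenerate F E σ hδ hd V b (ξ • Φ) f hΦ₁' hΦ₂' hb hf hφ'
  have hrec' : (pairLineDatum F E σ hσδ hδ hd f e hT).CompatibleSplitting := hrec F E σ δ hσδ hδ d hd _ f e he hT
  have hL := prop311_L2_of_record F E σ hσδ hδ hd V b (ξ • Φ) f e he hΦ₁' hΦ₂' hb hf hφ' ν hψc₀ hβc hΦ₃' hT hrec'
  obtain ⟨iL, hiL, -, hL'⟩ := hL
  -- (6) the rescaled model `ρ ∘ τ_ξ` (central character `ψ_F`) and a rational splitting for it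
  have hmodel := comp_heisTwist_printed_binders hξ ρ ψ (adeleAddChar F) hψ hρu hρc hρi hρz
  obtain ⟨hρ'u, hρ'c, hρ'i, hρ'z⟩ := hmodel
  have hsplit := exists_isRationalSplitting_smul hξ ρ i hi
  obtain ⟨i', hi'⟩ := hsplit
  -- (7) uniqueness of `ρ_ψ`: the body for the `L²` model gives it for `ρ ∘ τ_ξ`
  haveI : Nontrivial (Lp ℂ 2 ν) := nontrivial_L2_adele ν
  have h7 := conclusion_of_conclusion F E V (ξ • Φ) σ (adeleAddChar F) hψc₀ hψ₀.map_algebraMap hψ₀.ne_one hΦ₃' hφ' S _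
    hρ'u hρ'c hρ'i hρ'z i' hi' (Lp ℂ 2 ν)
    (l2Model F E σ hσδ hδ hd V b (ξ • Φ) f e he hΦ₁' hΦ₂' hb hf hφ' ν hψc₀ hβc)
    (norm_l2Model F E σ hσδ hδ hd V b (ξ • Φ) f e he hΦ₁' hΦ₂' hb hf hφ' ν hψc₀ hβc)
    (continuous_rep_comp_toCoordHeisenberg _ _ (adeleAddChar F) hψc₀ hβc ν)
    (irreducible_rep_comp_toCoordHeisenberg _ _ (adeleAddChar F) hψc₀ hβc ν hψ₀)
    (rep_comp_toCoordHeisenberg_ofCenter _ _ (adeleAddChar F) hψc₀ hβc ν) iL hiL hL'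
  -- (8) undo the rescaling
  exact conclusion_of_conclusion_smul hξ ρ σ hΦ₃ hφ hρu hρi i hi i' hi' h7

/-! ## The record for diagonal dual-pair data (the shape of `GRConstruction.gru_shape`) -/

/-- the diagonal Gram matrix `diag(d)` with non-zero entries is invertible. [cite: GelbartRogawski1991, §3.1 p. 454 L37–42] -/
theorem isUnit_det_diagonal_of_ne_zero {F : Type} [Field F] {N : ℕ} (dV : Fin N → F) (h0 : ∀ i, dV i ≠ 0) :
    IsUnit (Matrix.diagonal dV).det := by
  rw [Matrix.det_diagonal, isUnit_iff_ne_zero, Finset.prod_ne_zero_iff]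
  exact fun i _ => h0 i

/-- **The record for the general dual-pair datum with diagonal hermitian data** — [GelbartRogawski1991, Prop. 3.1.1] for
`G₁ = U(diag dV ⊗ diag dW)(𝐀_F)`, EVERY quadratic extension `E/F` (with an `F`-automorphism `c` and `δ ∈ E`, `c δ = -δ ≠ 0`,
`δ² = d ∈ F`), every re-indexing `e : Fin N × Fin M ≃ Fin n` and all non-zero diagonal data `dV : Fin N → F`, `dW : Fin M → F`, in
the tree's record form `SplittingDatum.CompatibleSplitting` of `UnitaryDualPair.splittingDatum`: the statement of the stage-1
record `GRConstruction.gru_shape` (CM data, `cmSplittingDatum`) at general `(F, E, c)` — the END statement of the general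
doubling construction. [cite: GelbartRogawski1991, §3.1 Proposition 3.1.1, p. 455 L1–3; §3.2 p. 457] -/
def DiagonalCompatibleSplitting : Prop :=
  ∀ (F : Type) [Field F] [NumberField F] (E : Type) [Field E] [NumberField E] [Algebra F E]
    [Algebra.IsQuadraticExtension F E] (c : E ≃ₐ[F] E) (δ : E) (hcδ : c δ = -δ) (hδ : δ ≠ 0) (d : F)
    (hd : δ * δ = algebraMap F E d) (N M n : ℕ) (e : Fin N × Fin M ≃ Fin n)
    (dV : Fin N → F) (hdV0 : ∀ i, dV i ≠ 0) (dW : Fin M → F) (hdW0 : ∀ j, dW j ≠ 0),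
    (splittingDatum F E c N M e ((Matrix.diagonal dV).map (algebraMap F E)) ((Matrix.diagonal dW).map (algebraMap F E))
      hcδ hδ hd (Matrix.isSymm_diagonal dV) (Matrix.isSymm_diagonal dW) (isUnit_det_diagonal_of_ne_zero dV hdV0)
      (isUnit_det_diagonal_of_ne_zero dW hdW0) rfl rfl).CompatibleSplitting

/-- **J9 at general `(F, E, σ)`: the diagonal record gives the dual-pair LINE record** (`N = n`, `M = 1`, `dVᵢ = -2 d fᵢ`, `dW = 1`:
`symplecticGram F d f = diag(-2 d fᵢ)` by definition, `diag 1 = 1`; all proof arguments of `splittingDatum` are irrelevant —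
`compatibleSplitting_splittingDatum_congr`). [cite: GelbartRogawski1991, §3.1 Proposition 3.1.1, p. 455 L1–2; §3.2 p. 457] -/
theorem pairLineCompatibleSplitting_of_diagonalCompatibleSplitting (h : DiagonalCompatibleSplitting) :
    PairLineCompatibleSplitting := by
  intro F _ _ E _ _ _ _ σ δ hσδ hδ d hd n f e _ hT
  have hf0 : ∀ i, -2 * d * f i ≠ 0 := by
    have h1 : (∏ i, (-2 * d * f i)) ≠ 0 := by
      have h2 := hT.ne_zero
      rwa [symplecticGram, Matrix.det_diagonal] at h2
    exact fun i => (Finset.prod_ne_zero_iff.1 h1) i (Finset.mem_univ i)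
  have h1 := h F E σ δ hσδ hδ d hd n 1 n e (fun i => -2 * d * f i) hf0 (fun _ => (1 : F)) (fun _ => one_ne_zero)
  exact (compatibleSplitting_splittingDatum_congr F E σ n 1 e hσδ hδ hd
    (Matrix.isSymm_diagonal fun i => -2 * d * f i) (Matrix.isSymm_diagonal fun _ : Fin 1 => (1 : F))
    (isUnit_det_diagonal_of_ne_zero (fun i => -2 * d * f i) hf0)
    (isUnit_det_diagonal_of_ne_zero (fun _ : Fin 1 => (1 : F)) fun _ => one_ne_zero) rfl rfl
    (isSymm_symplecticGram F d f) Matrix.isSymm_one hT (by rw [Matrix.det_one]; exact isUnit_one) rfl (one_eq_map_one F E)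
    rfl Matrix.diagonal_one.symm rfl (by rw [Matrix.diagonal_one]; exact one_eq_map_one F E)).1 h1

/-- **[GelbartRogawski1991, Proposition 3.1.1] AS PRINTED, for every quadratic extension of number fields, FROM THE RECORD FOR
DIAGONAL DUAL-PAIR DATA** (the END statement of the general doubling construction).
[cite: GelbartRogawski1991, §3.1 Proposition 3.1.1, p. 455 L1–2; §1.1 p. 449 L26–32; §3.1 p. 454 L17–42] -/
theorem prop311AsPrinted_of_diagonalCompatibleSplitting (h : DiagonalCompatibleSplitting) : Prop311AsPrinted :=
  prop311AsPrinted_of_pairLineCompatibleSplitting (pairLineCompatibleSplitting_of_diagonalCompatibleSplitting h)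

/-! ## The record for symmetric dual-pair data (the telescope of the general doubling files) -/

/-- **The record for the general dual-pair datum with symmetric hermitian data** — [GelbartRogawski1991, Prop. 3.1.1] for
`G₁ = U(T_V ⊗ T_W)(𝐀_F)`, EVERY quadratic extension `E/F` (with `c`, `δ`, `c δ = -δ ≠ 0`, `δ² = d`), every re-indexing `e`, all
symmetric invertible `T_V ∈ GL_N(F)`, `T_W ∈ GL_M(F)` (hermitian matrices `J = T ⊗_F E`), in the tree's record form
`SplittingDatum.CompatibleSplitting` of `UnitaryDualPair.splittingDatum` — the END statement of the general doubling construction in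
the telescope `(F E c hcδ hδ hd e TV hV hVd TW hW hWd)`. [cite: GelbartRogawski1991, §3.1 Proposition 3.1.1, p. 455 L1–3; §3.2 p. 457] -/
def SymmetricCompatibleSplitting : Prop :=
  ∀ (F : Type) [Field F] [NumberField F] (E : Type) [Field E] [NumberField E] [Algebra F E]
    [Algebra.IsQuadraticExtension F E] (c : E ≃ₐ[F] E) (δ : E) (hcδ : c δ = -δ) (hδ : δ ≠ 0) (d : F)
    (hd : δ * δ = algebraMap F E d) (N M n : ℕ) (e : Fin N × Fin M ≃ Fin n)
    (TV : Matrix (Fin N) (Fin N) F) (hV : TV.IsSymm) (hVd : IsUnit TV.det)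
    (TW : Matrix (Fin M) (Fin M) F) (hW : TW.IsSymm) (hWd : IsUnit TW.det),
    (splittingDatum F E c N M e (TV.map (algebraMap F E)) (TW.map (algebraMap F E)) hcδ hδ hd hV hW hVd hWd rfl rfl).CompatibleSplitting

/-- symmetric data ⊇ diagonal data. [cite: GelbartRogawski1991, §3.1 Proposition 3.1.1, p. 455 L1–3] -/
theorem diagonalCompatibleSplitting_of_symmetricCompatibleSplitting (h : SymmetricCompatibleSplitting) :
    DiagonalCompatibleSplitting :=
  fun F _ _ E _ _ _ _ c δ hcδ hδ d hd N M n e dV hdV0 dW hdW0 =>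
    h F E c δ hcδ hδ d hd N M n e (Matrix.diagonal dV) (Matrix.isSymm_diagonal dV) (isUnit_det_diagonal_of_ne_zero dV hdV0)
      (Matrix.diagonal dW) (Matrix.isSymm_diagonal dW) (isUnit_det_diagonal_of_ne_zero dW hdW0)

/-- **[GelbartRogawski1991, Proposition 3.1.1] AS PRINTED, for every quadratic extension of number fields, FROM THE RECORD FOR
SYMMETRIC DUAL-PAIR DATA** (the END statement of the general doubling construction in its own telescope).
[cite: GelbartRogawski1991, §3.1 Proposition 3.1.1, p. 455 L1–2; §1.1 p. 449 L26–32; §3.1 p. 454 L17–42] -/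
theorem prop311AsPrinted_of_symmetricCompatibleSplitting (h : SymmetricCompatibleSplitting) : Prop311AsPrinted :=
  prop311AsPrinted_of_diagonalCompatibleSplitting (diagonalCompatibleSplitting_of_symmetricCompatibleSplitting h)

end Prop311

end Literature.NumberTheory.GelbartRogawski1991

end
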